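import Summits.AtomisticToContinuum.FouriersLaw.Theorems.OddSectorIrreversibilityResponseDensityCutoffEnergy

/-!
# Momentum flip `Θ(q,p) = (q,-p)` and a weighted Cauchy–Schwarz bound for `Γ(χ_R, ·)`

Helper file for item stmt-AtomisticToContinuum-9144 (`ResponseDensity`, route
`OddSectorIrreversibility`, sub-problem `FouriersLaw` of `AtomisticToContinuum`), part of the
detailed-balance (hDUAL) line:

* `contDiff_comp_momentumFlip`, `hasCompactSupport_comp_momentumFlip`, `continuous_comp_momentumFlip` —
  `f ∘ Θ` inherits smoothness, compact support and continuity;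
* `abs_carreDuChamp_cutoff_le` — `|Γ(χ_R, w)| ≤ (1/2η) Γ(χ_R) + (η/2) χ_{4R}² Γ(w)` for the energy
  cutoffs `χ_R = χ(H/R)` of the pinned chain (`Γ = carreDuChamp v_L v_R`).

No definitions.
-/

noncomputable section

open MeasureTheory ProbabilityTheory Filter Topology Set Function Metric
open scoped NNReal ENNReal ContDiff

namespace Summit.AtomisticToContinuum.FouriersLaw.Theorems

open Literature.MathematicalPhysics.KineticTheory.HeatConduction
open Literature.Probability.Process Literature.MathematicalPhysics.KineticTheory OscillatorChain

variable {N : ℕ}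

/-- `f ∘ Θ` is as smooth as `f`. -/
theorem contDiff_comp_momentumFlip {n : WithTop ℕ∞} {f : PhaseSpace N → ℝ} (hf : ContDiff ℝ n f) :
    ContDiff ℝ n fun y : PhaseSpace N => f (y.1, -y.2) :=
  hf.comp (contDiff_fst.prodMk contDiff_snd.neg)

/-- `f ∘ Θ` is compactly supported if `f` is. -/
theorem hasCompactSupport_comp_momentumFlip {f : PhaseSpace N → ℝ} (hf : HasCompactSupport f) :
    HasCompactSupport fun y : PhaseSpace N => f (y.1, -y.2) := by
  have e : (fun y : PhaseSpace N => f (y.1, -y.2)) = f ∘ (momentumReversal N) := by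
    funext y; simp
  rw [e]
  exact hf.comp_homeomorph ((Homeomorph.refl (Fin N → ℝ)).prodCongr (Homeomorph.neg (Fin N → ℝ)))

/-- `f ∘ Θ` is continuous if `f` is. -/
theorem continuous_comp_momentumFlip {f : PhaseSpace N → ℝ} (hf : Continuous f) :
    Continuous fun y : PhaseSpace N => f (y.1, -y.2) :=
  hf.comp (continuous_fst.prodMk continuous_snd.neg)

/-- **Weighted Cauchy–Schwarz for `Γ(χ_R, w)` with the wider cutoff**: for `η > 0`, `R > 0`,
`|Γ(χ_R, w)(y)| ≤ (1/2η) Γ(χ_R)(y) + (η/2) χ_{4R}(y)² Γ(w)(y)` (where `Dχ_R(y) ≠ 0` one has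
`H(y) < 2R`, so `χ_{4R}(y) = 1`). -/
theorem abs_carreDuChamp_cutoff_le {ω₂ lam β γ : ℝ} (N : ℕ) (T : ℝ) {R : ℝ} (hR : 0 < R) {η : ℝ} (hη : 0 < η)
    {w : PhaseSpace N → ℝ} (y : PhaseSpace N) :
    |carreDuChamp ((pinnedChain ω₂ lam β γ).bathVecL N T) ((pinnedChain ω₂ lam β γ).bathVecR N T)
        (fun z => smoothCutoff ((pinnedChain ω₂ lam β γ).hamiltonian N z / R)) w y| ≤
      1 / (2 * η) * carreDuChamp ((pinnedChain ω₂ lam β γ).bathVecL N T) ((pinnedChain ω₂ lam β γ).bathVecR N T)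
          (fun z => smoothCutoff ((pinnedChain ω₂ lam β γ).hamiltonian N z / R))
          (fun z => smoothCutoff ((pinnedChain ω₂ lam β γ).hamiltonian N z / R)) y +
        η / 2 * (smoothCutoff ((pinnedChain ω₂ lam β γ).hamiltonian N y / (4 * R)) ^ 2 *
          carreDuChamp ((pinnedChain ω₂ lam β γ).bathVecL N T) ((pinnedChain ω₂ lam β γ).bathVecR N T) w w y) := by
  have hH : Differentiable ℝ ((pinnedChain ω₂ lam β γ).hamiltonian N) :=
    (pinnedChain_contDiff_hamiltonian ω₂ lam β γ N (n := 1)).differentiable one_ne_zero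
  by_cases hfar : 2 * R < (pinnedChain ω₂ lam β γ).hamiltonian N y
  · -- the cutoff is flat here: `Γ(χ_R, ·)(y) = 0`
    have h0 : carreDuChamp ((pinnedChain ω₂ lam β γ).bathVecL N T) ((pinnedChain ω₂ lam β γ).bathVecR N T)
        (fun z => smoothCutoff ((pinnedChain ω₂ lam β γ).hamiltonian N z / R)) w y = 0 := by
      rw [carreDuChamp_comp_left _ _ (hasDerivAt_cutoffProfile R) hH,
        deriv_smoothCutoff_of_two_lt ((lt_div_iff₀ hR).2 (by linarith)), zero_div, zero_mul]
    rw [h0, abs_zero]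
    exact add_nonneg (mul_nonneg (by positivity) (carreDuChamp_self_nonneg _ _ _ _))
      (mul_nonneg (by positivity) (mul_nonneg (sq_nonneg _) (carreDuChamp_self_nonneg _ _ _ _)))
  · -- here `χ_{4R}(y) = 1`
    have h1 : smoothCutoff ((pinnedChain ω₂ lam β γ).hamiltonian N y / (4 * R)) = 1 := by
      apply smoothCutoff_of_le_one
      rw [div_le_one (by positivity)]
      linarith
    rw [h1, one_pow, one_mul, carreDuChamp_def, carreDuChamp_def, carreDuChamp_def]
    set a₁ := fderiv ℝ (fun z => smoothCutoff ((pinnedChain ω₂ lam β γ).hamiltonian N z / R)) y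
      ((pinnedChain ω₂ lam β γ).bathVecL N T)
    set a₂ := fderiv ℝ (fun z => smoothCutoff ((pinnedChain ω₂ lam β γ).hamiltonian N z / R)) y
      ((pinnedChain ω₂ lam β γ).bathVecR N T)
    set b₁ := fderiv ℝ w y ((pinnedChain ω₂ lam β γ).bathVecL N T)
    set b₂ := fderiv ℝ w y ((pinnedChain ω₂ lam β γ).bathVecR N T)
    rw [abs_le]
    have h2η : 0 < 2 * η := by positivity
    constructor
    · have key : 0 ≤ 1 / (2 * η) * (a₁ + η * b₁) ^ 2 + 1 / (2 * η) * (a₂ + η * b₂) ^ 2 := by positivity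
      have e : 1 / (2 * η) * (a₁ + η * b₁) ^ 2 + 1 / (2 * η) * (a₂ + η * b₂) ^ 2 =
          1 / (2 * η) * (a₁ * a₁ + a₂ * a₂) + η / 2 * (b₁ * b₁ + b₂ * b₂) + (a₁ * b₁ + a₂ * b₂) := by
        field_simp; ring
      linarith
    · have key : 0 ≤ 1 / (2 * η) * (a₁ - η * b₁) ^ 2 + 1 / (2 * η) * (a₂ - η * b₂) ^ 2 := by positivity
      have e : 1 / (2 * η) * (a₁ - η * b₁) ^ 2 + 1 / (2 * η) * (a₂ - η * b₂) ^ 2 =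
          1 / (2 * η) * (a₁ * a₁ + a₂ * a₂) + η / 2 * (b₁ * b₁ + b₂ * b₂) - (a₁ * b₁ + a₂ * b₂) := by
        field_simp; ring
      linarith

end Summit.AtomisticToContinuum.FouriersLaw.Theorems

end
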